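import Mathlib
import HarnessLib
import Literature.MathematicalPhysics.QuantumLattice.GaugeGroups
import Literature.LinearAlgebra.Matrix.UnitaryGroupMaximalTorus
import Literature.LinearAlgebra.Matrix.SpecialUnitaryGroupConjugacyClasses
import Summits.Ventures.LatticeQCDFlow.Exactness.CircleGroupJacobian
import Summits.Ventures.LatticeQCDFlow.Exactness.SpectralKernelJacobianWeylShapeSU
import Summits.Ventures.LatticeQCDFlow.Exactness.TorusCircleChart
import Summits.Ventures.LatticeQCDFlow.Exactness.SU2TorusAlcoveJacobian

/-!
# The walls of the Weyl alcove are Haar-null: on `SΔ(n)` two eigenvalues coincide with probability zero, so the Vandermonde weight is a.e. non-zero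

HONEST FRAMING: exact (Metropolis-corrected) sampling algorithms for lattice gauge theory;
figures of merit are autocorrelation/cost numbers at stated couplings and volumes; no
continuum-physics claim.

Venture `LatticeQCDFlow` (cell pub-lqcd), topic `Exactness`; FANOUT row 10 (`eng-equiv`, engine
`latflow.equiv` `spectral.py`: "eigenvalue (near-)degeneracy is a measure-zero wall of the cell where
Haar → 0; `alpha` is clipped to `[1e-15, 1 − 1e-15]` before logs").  NEW WORK of the cell — the item
"`|Δ(t)| ≠ 0` Haar-a.e." of LEANMAP-gen7 §C — over this row's
`TorusCircleChart.map_eq_haarProbability_of_mul_of_surjective` (a continuous surjective homomorphism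
onto a compact group presents its Haar probability) and `SU2TorusAlcoveJacobian.haarProbability_circle_eq_map_exp`.
No Fubini: the wall `{t_ii = t_jj}` is the kernel-coset `φ⁻¹{1}` of the continuous surjective
homomorphism `φ(t) = t_ii t_jj⁻¹ : SΔ(n) → U(1)`, so its Haar mass is `Haar_{U(1)}{1} = 0`.
Nothing is cited as a fact; no number; no definition.

## What is typed

* `haarProbability_circle_singleton` — points are null for `Haar_{U(1)}`;
* `exists_sq_eq_circle` — squaring is onto `U(1)`;
* `diagonal_pair_update_mem_specialUnitaryGroup` — `diag(…, u (at i), …, u⁻¹ (at j), …, 1, …) ∈ SU(n)`;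
* **`haarProbability_specialDiagonalTorus_wall`** — `Haar_{SΔ(n)} {t | t_ii = t_jj} = 0` for `i ≠ j`;
* **`haarProbability_specialDiagonalTorus_walls`** — `Haar_{SΔ(n)} {t | ∃ i ≠ j, t_ii = t_jj} = 0`;
* **`vandermondeWeight_ne_zero_ae`** — `∏_i ∏_{j≠i} ‖t_ii − t_jj‖ ≠ 0` for `Haar_{SΔ(n)}`-a.e. `t`
  (the weight of `weylIntegralFormula_specialUnitary` is a.e. positive: the chambers carry all the mass).

NOT here: the chamber decomposition itself (step 2 towards the `N ≥ 3` alcove); any number.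
-/

noncomputable section

namespace Summit.Ventures.LatticeQCDFlow.Exactness

open MeasureTheory Matrix Topology Set Real
open Literature.LinearAlgebra.Matrix
open Literature.MathematicalPhysics.QuantumFieldTheory (haarProbability)
open scoped ENNReal

/-! ## `U(1)`: points are null, squaring is onto -/

/-- **Points are `Haar_{U(1)}`-null.** -/
theorem haarProbability_circle_singleton (z : Circle) : haarProbability Circle {z} = 0 := by
  rw [haarProbability_circle_eq_map_exp, Measure.smul_apply,
    Measure.map_apply Circle.exp.continuous.measurable (measurableSet_singleton z),
    Measure.restrict_apply (Circle.exp.continuous.measurable (measurableSet_singleton z)), smul_eq_mul]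
  have hsub : ((fun θ : ℝ => Circle.exp θ) ⁻¹' {z} ∩ Ioc (-π) π).Subsingleton := by
    intro a ha b hb
    have hinj := Circle.exp_injOn_Ioc (a := -π) (b := π) (by linarith [pi_pos])
    exact hinj ha.2 hb.2 (ha.1.trans hb.1.symm)
  rw [hsub.measure_zero, mul_zero]

/-- **Squaring is onto `U(1)`**: every `w` is `u²` with `u = e^{i arg(w)/2}`. -/
theorem exists_sq_eq_circle (w : Circle) : ∃ u : Circle, u * u = w :=
  ⟨Circle.exp (Complex.arg (w : ℂ) / 2), by rw [← Circle.exp_add, add_halves, Circle.exp_arg]⟩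

variable {n : Type*} [Fintype n] [DecidableEq n]

omit [DecidableEq n] in
/-- The coercion `U(1) → ℂ` is multiplicative on finite products. -/
private theorem coe_prod_circle (f : n → Circle) : ((∏ k, f k : Circle) : ℂ) = ∏ k, (f k : ℂ) :=
  map_prod Circle.coeHom f Finset.univ

/-- `diag(…, u at i, …, u⁻¹ at j, …, 1 elsewhere) ∈ SU(n)` for `i ≠ j`. -/
theorem diagonal_pair_update_mem_specialUnitaryGroup {i j : n} (hij : i ≠ j) (u : Circle) :
    diagonal (fun k => ((Function.update (Function.update (fun _ : n => (1 : Circle)) i u) j u⁻¹ k : Circle) : ℂ)) ∈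
      Matrix.specialUnitaryGroup n ℂ := by
  refine (Literature.MathematicalPhysics.QuantumLattice.diagonal_mem_specialUnitaryGroup_iff _).mpr
    ⟨fun k => Circle.norm_coe _, ?_⟩
  rw [← coe_prod_circle, Finset.prod_update_of_mem (Finset.mem_univ j), Finset.prod_update_of_mem
      (Finset.mem_sdiff.mpr ⟨Finset.mem_univ i, fun h => hij (Finset.mem_singleton.mp h)⟩),
    Finset.prod_const_one, mul_one, inv_mul_cancel, Circle.coe_one]

/-! ## The walls of `SΔ(n)` are null -/

/-- **The wall `{t_ii = t_jj}` is `Haar_{SΔ(n)}`-null** (`i ≠ j`): it is `φ⁻¹{1}` for the continuous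
surjective homomorphism `φ(t) = t_ii · t_jj⁻¹ : SΔ(n) → U(1)`, so its mass is `Haar_{U(1)}{1} = 0`. -/
theorem haarProbability_specialDiagonalTorus_wall {i j : n} (hij : i ≠ j) :
    haarProbability (specialDiagonalTorus n)
      {t : specialDiagonalTorus n | ((t : Matrix.specialUnitaryGroup n ℂ) : Matrix n n ℂ) i i =
        ((t : Matrix.specialUnitaryGroup n ℂ) : Matrix n n ℂ) j j} = 0 := by
  haveI : SecondCountableTopology (specialDiagonalTorus n) := secondCountableTopology_specialDiagonalTorus
  -- the unimodular entries as points of `U(1)`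
  set e : n → specialDiagonalTorus n → Circle := fun k t =>
    ⟨((t : Matrix.specialUnitaryGroup n ℂ) : Matrix n n ℂ) k k,
      mem_sphere_zero_iff_norm.mpr (norm_specialDiagonalTorus_apply t k)⟩ with he
  have hecoe : ∀ k t, ((e k t : Circle) : ℂ) = ((t : Matrix.specialUnitaryGroup n ℂ) : Matrix n n ℂ) k k :=
    fun k t => rfl
  have hecont : ∀ k, Continuous (e k) := by
    intro k
    have h1 : Continuous fun t : specialDiagonalTorus n =>
        ((t : Matrix.specialUnitaryGroup n ℂ) : Matrix n n ℂ) k k :=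
      (continuous_apply k).comp ((continuous_apply k).comp (continuous_subtype_val.comp continuous_subtype_val))
    exact h1.subtype_mk _
  have hemul : ∀ k (s t : specialDiagonalTorus n), e k (s * t) = e k s * e k t := by
    intro k s t
    apply Circle.ext
    rw [Circle.coe_mul, hecoe, hecoe, hecoe]
    have hst : (((s * t : specialDiagonalTorus n) : Matrix.specialUnitaryGroup n ℂ) : Matrix n n ℂ) =
        ((s : Matrix.specialUnitaryGroup n ℂ) : Matrix n n ℂ) * ((t : Matrix.specialUnitaryGroup n ℂ) :
          Matrix n n ℂ) := rfl
    rw [hst]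
    conv_lhs => rw [coe_specialDiagonalTorus_eq_diagonal s, coe_specialDiagonalTorus_eq_diagonal t,
      diagonal_mul_diagonal, diagonal_apply_eq]
  -- the homomorphism `φ = e i · (e j)⁻¹`
  set φ : specialDiagonalTorus n → Circle := fun t => e i t * (e j t)⁻¹ with hφ
  have hφm : Measurable φ := ((hecont i).mul (hecont j).inv).measurable
  have hφmul : ∀ s t, φ (s * t) = φ s * φ t := by
    intro s t
    simp only [hφ, hemul, mul_inv]
    rw [mul_mul_mul_comm]
  have hφsurj : Function.Surjective φ := by
    intro w
    obtain ⟨u, hu⟩ := exists_sq_eq_circle w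
    refine ⟨⟨⟨diagonal (fun k => ((Function.update (Function.update (fun _ : n => (1 : Circle)) i u) j u⁻¹ k :
        Circle) : ℂ)), diagonal_pair_update_mem_specialUnitaryGroup hij u⟩, ⟨_, rfl⟩⟩, ?_⟩
    apply Circle.ext
    rw [← hu]
    simp only [hφ, he, Circle.coe_mul, Circle.coe_inv]
    rw [diagonal_apply_eq, diagonal_apply_eq, Function.update_of_ne hij, Function.update_self,
      Function.update_self, Circle.coe_inv, inv_inv]
  have hmap : Measure.map φ (haarProbability (specialDiagonalTorus n)) = haarProbability Circle :=
    map_eq_haarProbability_of_mul_of_surjective _ hφm hφmul hφsurj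
  -- the wall is `φ⁻¹ {1}`
  have hwall : {t : specialDiagonalTorus n | ((t : Matrix.specialUnitaryGroup n ℂ) : Matrix n n ℂ) i i =
      ((t : Matrix.specialUnitaryGroup n ℂ) : Matrix n n ℂ) j j} = φ ⁻¹' {1} := by
    ext t
    simp only [Set.mem_setOf_eq, Set.mem_preimage, Set.mem_singleton_iff, hφ]
    rw [mul_inv_eq_one]
    constructor
    · intro h
      exact Circle.ext (by rw [hecoe, hecoe]; exact h)
    · intro h
      have h' := congrArg Subtype.val h
      rwa [hecoe, hecoe] at h'
  rw [hwall, ← Measure.map_apply hφm (measurableSet_singleton 1), hmap, haarProbability_circle_singleton]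

/-- **All walls together are null**: `Haar_{SΔ(n)} {t | ∃ i ≠ j, t_ii = t_jj} = 0`. -/
theorem haarProbability_specialDiagonalTorus_walls :
    haarProbability (specialDiagonalTorus n)
      {t : specialDiagonalTorus n | ∃ i j : n, i ≠ j ∧ ((t : Matrix.specialUnitaryGroup n ℂ) : Matrix n n ℂ) i i =
        ((t : Matrix.specialUnitaryGroup n ℂ) : Matrix n n ℂ) j j} = 0 := by
  have hset : {t : specialDiagonalTorus n | ∃ i j : n, i ≠ j ∧
      ((t : Matrix.specialUnitaryGroup n ℂ) : Matrix n n ℂ) i i = ((t : Matrix.specialUnitaryGroup n ℂ) :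
        Matrix n n ℂ) j j} =
      ⋃ i : n, ⋃ j : n, {t : specialDiagonalTorus n | i ≠ j ∧
        ((t : Matrix.specialUnitaryGroup n ℂ) : Matrix n n ℂ) i i = ((t : Matrix.specialUnitaryGroup n ℂ) :
          Matrix n n ℂ) j j} := by
    ext t
    simp only [Set.mem_setOf_eq, Set.mem_iUnion]
  rw [hset]
  refine measure_iUnion_null fun i => measure_iUnion_null fun j => ?_
  by_cases hij : i = j
  · exact measure_mono_null (fun t ht => (ht.1 hij).elim) (measure_empty (μ := haarProbability _))
  · have hsub : {t : specialDiagonalTorus n | i ≠ j ∧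
        ((t : Matrix.specialUnitaryGroup n ℂ) : Matrix n n ℂ) i i = ((t : Matrix.specialUnitaryGroup n ℂ) :
          Matrix n n ℂ) j j} ⊆
        {t : specialDiagonalTorus n | ((t : Matrix.specialUnitaryGroup n ℂ) : Matrix n n ℂ) i i =
          ((t : Matrix.specialUnitaryGroup n ℂ) : Matrix n n ℂ) j j} := fun t ht => ht.2
    exact measure_mono_null hsub (haarProbability_specialDiagonalTorus_wall hij)

/-- **The Vandermonde weight is a.e. non-zero**: for `Haar_{SΔ(n)}`-a.e. `t`,
`∏_i ∏_{j≠i} ‖t_ii − t_jj‖ ≠ 0` — the weight of `weylIntegralFormula_specialUnitary n` vanishes only on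
the walls. -/
theorem vandermondeWeight_ne_zero_ae :
    ∀ᵐ t : specialDiagonalTorus n ∂(haarProbability (specialDiagonalTorus n)),
      (∏ i, ∏ j ∈ Finset.univ.erase i,
        ‖((t : Matrix.specialUnitaryGroup n ℂ) : Matrix n n ℂ) i i -
          ((t : Matrix.specialUnitaryGroup n ℂ) : Matrix n n ℂ) j j‖) ≠ 0 := by
  rw [ae_iff]
  refine measure_mono_null (fun t ht => ?_) haarProbability_specialDiagonalTorus_walls
  simp only [Set.mem_setOf_eq, not_not] at ht
  obtain ⟨i, -, hi⟩ := Finset.prod_eq_zero_iff.mp ht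
  obtain ⟨j, hj, hij⟩ := Finset.prod_eq_zero_iff.mp hi
  exact ⟨i, j, (Finset.ne_of_mem_erase hj).symm, sub_eq_zero.mp (norm_eq_zero.mp hij)⟩

end Summit.Ventures.LatticeQCDFlow.Exactness
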